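import Literature.NumberTheory.GaloisRepresentations.LubinTateComparisonPoints
import Literature.NumberTheory.GaloisRepresentations.DiscreteValuationDivisibleUnits
import Mathlib.RingTheory.RootsOfUnity.AlgebraicallyClosed
import HarnessLib

/-!
# `p`-power roots of unity in `ℂ_F` are points of the open unit ball, and the `Ĝ_m`-torsion
# `{w − 1 : w^p = 1}` is in bijection with the `𝓀_F`-indexed `π`-division points `ω_c` under any
# injective torsion-preserving map of `𝔪_ℂ` (counting)

Topic `NumberTheory/GaloisRepresentations`; namespace `Literature.NumberTheory.GaloisRepresentations`.
Cell `bsd-print-cf2` (HOME `run/shared/lean/pub/bsd-print-cf2/`), seat `bsd-line-cf2-p1-w7` g7, planner g20's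
assignment (2026-08-29T11:51:38Z): **GAP-4** of cf2c-w4 g5's `Cruxes/TwoVariableMainConjAtSplitTwoQuad/
ASSEMBLY-GUIDE-measure-side-w4g5.md` §1 — «the bijection `c ↦ w_c` between the `𝓀_F`-indexed division points
`ltDivPt hπ n c` and `μ_p`, from `ϑ` injective on `𝔪` (`evalPt₁_injective`) + torsion transport (p715802) +
counting», needed to rewrite de Shalit's `Σ_c h(x [+]_f ω_c) = 0` at `x = ϑ(ε − 1)` as
`Σ_{w^p = 1} h(ϑ(εw − 1)) = 0` (I §3.3 (7)).

Setting: `F` a non-archimedean local field, `ℂ_F = \widehat{F̄}` (`CompletedAlgClosure F`), `𝒪_{ℂ_F} = CBall F`,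
`𝔪_ℂ = maxNilIdealC F` (file `LubinTateComparisonPoints.lean`). Contents (all proved):

* §1 `norm_natCast_lt_one_of_mem_maximalIdeal`, `natCast_ringChar_residueField_mem_maximalIdeal` — the residue
  characteristic has `‖p‖ < 1` in `ℂ_F`; **`norm_sub_one_lt_one_of_pow_prime_pow_eq_one`** — a `p`-power root of
  unity `ζ ∈ ℂ_F` has `‖ζ − 1‖ < 1`, i.e. `ζ − 1 ∈ 𝔪_ℂ` (tree `valuation_sub_one_lt_one_of_pow_prime_pow` for the
  norm valuation of `ℂ_F`); `exists_point_coe_eq_sub_one` (the point `ζ − 1 ∈ 𝔪_ℂ`).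
* §2 `card_nthRootsFinset_completedAlgClosure` — `ℂ_F` has exactly `p` `p`-th roots of unity (`char F = 0`):
  a primitive one exists in `F̄` (Mathlib `AlgebraicClosure.hasEnoughRootsOfUnity`) and `F̄ → ℂ_F` is injective.
* §3 **`exists_rootsOfUnity_enum_of_torsion_transport`** — THE BIJECTION: if `#𝓀_F = p`, `ω : 𝓀_F → 𝔪_ℂ` is
  any family (the division points) and `Θ : 𝔪_ℂ → 𝔪_ℂ` is injective (e.g. `z ↦ ϑ(z)`, `evalPt₁_injective`) and
  sends every `Ĝ_m`-torsion point `z` (`(1 + z)^p = 1`) to some `ω c` (torsion transport), then there is an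
  INJECTIVE enumeration `w : 𝓀_F → ℂ_F` of `p`-th roots of unity with `Θ(w c − 1) = ω c` for every `c`
  (pigeonhole on two `p`-element sets); with `sum_eq_sum_nthRootsFinset` (cf2c-w4 g5) this re-indexes `Σ_c` as
  `Σ_{w ∈ nthRootsFinset p 1}`.
(The division points `ω_c ∈ 𝒪_{K_π^{n+1}}` read in `𝔪_ℂ`, i.e. the `ω` of §3, and the identification of the
`f`-torsion of `𝔪_ℂ` with them are in the sequel `LubinTateDivisionPointsCBall.lean`.)

No definition, no named fact, no `sorry`. HONEST FRAMING: local analytic bookkeeping for brick (d) of the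
(Q)-socket of the cell's M-LINE-PIN; nothing about elliptic curves; BSD is not advanced by this file.

## References
* [deShalit1987] E. de Shalit, *Iwasawa theory of elliptic curves with complex multiplication* (1987), I §3.2
  (3)–(5), §3.3 (7).
* [CasselsFrohlichANT1967] J.-P. Serre, *Local class field theory* (Cassels–Fröhlich Ch. VI), §3.6 Prop. 6 (a)
  (the `q` division points of level one).
* [SerreLocalFields1979] J.-P. Serre, *Local Fields*, Ch. II §2 Cor. 3, Ch. IV §4 Prop. 17 (`v(ζ − 1)` for
  `p`-power roots of unity).
-/

noncomputable section

open MvPowerSeries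

namespace Literature.NumberTheory.GaloisRepresentations

open ValuativeRel IsLocalRing Field IsNonarchimedeanLocalField LubinTate
open Literature.NumberTheory.PAdicHodge

variable {F : Type} [Field F] [ValuativeRel F] [TopologicalSpace F] [IsNonarchimedeanLocalField F]

/-! ### §1. `p`-power roots of unity lie in `1 + 𝔪_ℂ` -/

/-- A natural number lying in the maximal ideal of `𝒪_F` has norm `< 1` in `ℂ_F`.
[cite: SerreLocalFields1979, Ch. II §2 Cor. 3] -/
theorem norm_natCast_lt_one_of_mem_maximalIdeal {m : ℕ} (hm : ((m : ℕ) : 𝒪[F]) ∈ 𝓂[F]) :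
    ‖(m : CompletedAlgClosure F)‖ < 1 := by
  letI := nontriviallyNormedField F
  have hv : valuation F (((m : ℕ) : 𝒪[F]) : F) < 1 := (mem_maximalIdeal_iff_valuation_lt_one _).mp hm
  have hcast : (m : CompletedAlgClosure F) = algebraMap F (CompletedAlgClosure F) (((m : ℕ) : 𝒪[F]) : F) := by
    simp
  rw [hcast, CompletedAlgClosure.norm_algebraMap]
  exact (norm_lt_one_iff F _).mpr hv

/-- The residue characteristic `p = char 𝓀_F` lies in `𝓂_F`. [cite: SerreLocalFields1979, Ch. II §2 Cor. 3] -/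
theorem natCast_ringChar_residueField_mem_maximalIdeal :
    ((ringChar 𝓀[F] : ℕ) : 𝒪[F]) ∈ 𝓂[F] := by
  rw [← IsLocalRing.residue_eq_zero_iff, map_natCast]
  exact ringChar.Nat.cast_ringChar

/-- The residue characteristic has norm `< 1` in `ℂ_F`. [cite: SerreLocalFields1979, Ch. II §2 Cor. 3] -/
theorem norm_natCast_ringChar_residueField_lt_one :
    ‖((ringChar 𝓀[F] : ℕ) : CompletedAlgClosure F)‖ < 1 :=
  norm_natCast_lt_one_of_mem_maximalIdeal (natCast_ringChar_residueField_mem_maximalIdeal (F := F))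

/-- **A `p`-power root of unity is a principal unit of `ℂ_F`**: if `‖p‖ < 1` in `ℂ_F` and `ζ^{p^n} = 1` then
`‖ζ − 1‖ < 1` (`(ζ − 1)^{p^n} ≡ ζ^{p^n} − 1 (mod p)`, the tree's `valuation_sub_one_lt_one_of_pow_prime_pow` for
the norm valuation of the ultrametric field `ℂ_F`). [cite: SerreLocalFields1979, Ch. IV §4 Prop. 17] -/
theorem norm_sub_one_lt_one_of_pow_prime_pow_eq_one {p : ℕ} [hp : Fact p.Prime]
    (hpC : ‖(p : CompletedAlgClosure F)‖ < 1) {ζ : CompletedAlgClosure F} (n : ℕ) (hζ : ζ ^ p ^ n = 1) :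
    ‖ζ - 1‖ < 1 := by
  have hk : p ^ n ≠ 0 := pow_ne_zero n hp.out.ne_zero
  have hζ1 : ‖ζ‖ ≤ 1 := by
    have h1 : ‖ζ‖ ^ (p ^ n) = 1 := by rw [← norm_pow, hζ, norm_one]
    exact ((pow_eq_one_iff_of_nonneg (norm_nonneg ζ) hk).mp h1).le
  have key := valuation_sub_one_lt_one_of_pow_prime_pow (NormedField.valuation (K := CompletedAlgClosure F))
    (p := p) (u := ζ) ?_ ?_ n ?_
  · rw [NormedField.valuation_apply, ← NNReal.coe_lt_coe, coe_nnnorm, NNReal.coe_one] at key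
    exact key
  · rw [NormedField.valuation_apply, ← NNReal.coe_lt_coe, coe_nnnorm, NNReal.coe_one]
    exact hpC
  · rw [NormedField.valuation_apply, ← NNReal.coe_le_coe, coe_nnnorm, NNReal.coe_one]
    exact hζ1
  · rw [hζ, sub_self, map_zero]
    exact zero_lt_one

/-- The point `ζ − 1 ∈ 𝔪_ℂ` attached to a `p`-power root of unity `ζ` (existence form: an element of the
open unit ball `maxNilIdealC F` of `𝒪_{ℂ_F}` with underlying value `ζ − 1`). [cite: deShalit1987, I §3.2 (3)–(5)] -/
theorem exists_point_coe_eq_sub_one {p : ℕ} [Fact p.Prime] (hpC : ‖(p : CompletedAlgClosure F)‖ < 1)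
    {ζ : CompletedAlgClosure F} (n : ℕ) (hζ : ζ ^ p ^ n = 1) :
    ∃ z : (maxNilIdealC F).toIdeal, ((z : CBall F) : CompletedAlgClosure F) = ζ - 1 := by
  have h := norm_sub_one_lt_one_of_pow_prime_pow_eq_one hpC n hζ
  exact ⟨⟨⟨ζ - 1, (mem_unitBall_iff _).mpr h.le⟩, h⟩, rfl⟩

/-! ### §2. `ℂ_F` has exactly `p` `p`-th roots of unity (characteristic zero) -/

/-- `F̄ → ℂ_F` is injective (a ring map out of a field). [cite: SerreLocalFields1979, Ch. II §2 Cor. 3] -/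
theorem algClosureToC_injective : Function.Injective (algClosureToC F) := (algClosureToC F).injective

/-- **`#μ_p(ℂ_F) = p`** when `p ≠ 0` in `F`: a primitive `p`-th root of unity exists in `F̄` (Mathlib,
algebraically closed fields have enough roots of unity) and maps injectively into `ℂ_F`.
[cite: SerreLocalFields1979, Ch. IV §4 Prop. 17] -/
theorem card_nthRootsFinset_completedAlgClosure (p : ℕ) [Fact p.Prime] [NeZero (p : F)] :
    (Polynomial.nthRootsFinset p (1 : CompletedAlgClosure F)).card = p := by
  obtain ⟨ζ, hζ⟩ := HasEnoughRootsOfUnity.exists_primitiveRoot (AlgebraicClosure F) p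
  exact (hζ.map_of_injective (algClosureToC_injective (F := F))).card_nthRootsFinset

/-! ### §3. The bijection `c ↦ w_c`: `Ĝ_m`-torsion ↔ division points under an injective torsion-preserving map -/

/-- **GAP-4: enumeration of the `p`-th roots of unity by the residue field through the division points.**
Let `#𝓀_F = p`, `p ≠ 0` in `F`, `‖p‖ < 1` in `ℂ_F`; let `ω : 𝓀_F → 𝔪_ℂ` be any family (the `π`-division points
`ω_c`; its injectivity FOLLOWS) and `Θ : 𝔪_ℂ → 𝔪_ℂ` injective (the comparison `z ↦ ϑ(z)`, `evalPt₁_injective`) such that every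
`Ĝ_m`-torsion point `z` (`(1 + z)^p = 1`) is sent to some `ω c` (torsion transport, `ϑ ∘ [p]_{Ĝ_m} = [p]_f ∘ ϑ`).
Then there is an INJECTIVE `w : 𝓀_F → ℂ_F` with `(w c)^p = 1` and a point `z_c ∈ 𝔪_ℂ`, `z_c = w c − 1`, with
`Θ z_c = ω c`, for every `c` — pigeonhole: `w ↦ Θ(w − 1)` is an injection of the `p`-element set `μ_p` into the
`p`-element image of `ω`. [cite: deShalit1987, I §3.3 (7)] [cite: CasselsFrohlichANT1967, Ch. VI §3.6 Prop. 6 (a)] -/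
theorem exists_rootsOfUnity_enum_of_torsion_transport {p : ℕ} [hp : Fact p.Prime] [NeZero (p : F)]
    (hpC : ‖(p : CompletedAlgClosure F)‖ < 1) (hq : Nat.card 𝓀[F] = p)
    (ω : 𝓀[F] → (maxNilIdealC F).toIdeal)
    (Θ : (maxNilIdealC F).toIdeal → (maxNilIdealC F).toIdeal) (hΘ : Function.Injective Θ)
    (hΘω : ∀ z : (maxNilIdealC F).toIdeal,
      ((1 : CompletedAlgClosure F) + ((z : CBall F) : CompletedAlgClosure F)) ^ p = 1 → ∃ c, Θ z = ω c) :
    ∃ w : 𝓀[F] → CompletedAlgClosure F, Function.Injective w ∧ (∀ c, w c ^ p = 1) ∧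
      ∀ c, ∃ z : (maxNilIdealC F).toIdeal, ((z : CBall F) : CompletedAlgClosure F) = w c - 1 ∧ Θ z = ω c := by
  classical
  letI : Fintype 𝓀[F] := Fintype.ofFinite _
  set S := Polynomial.nthRootsFinset p (1 : CompletedAlgClosure F) with hSdef
  have hScard : S.card = p := card_nthRootsFinset_completedAlgClosure (F := F) p
  have hmemS : ∀ {ζ : CompletedAlgClosure F}, ζ ∈ S ↔ ζ ^ p = 1 := fun {ζ} =>
    Polynomial.mem_nthRootsFinset hp.out.pos (1 : CompletedAlgClosure F)
  -- the point `ζ - 1 ∈ 𝔪_ℂ` of a `p`-th root of unity `ζ`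
  have hlt : ∀ ζ : S, ‖(ζ : CompletedAlgClosure F) - 1‖ < 1 := fun ζ =>
    norm_sub_one_lt_one_of_pow_prime_pow_eq_one hpC 1 (by rw [pow_one]; exact hmemS.mp ζ.2)
  set pt : S → (maxNilIdealC F).toIdeal := fun ζ =>
    ⟨⟨(ζ : CompletedAlgClosure F) - 1, (mem_unitBall_iff _).mpr (hlt ζ).le⟩, hlt ζ⟩ with hptdef
  have hpt_coe : ∀ ζ : S, (((pt ζ : (maxNilIdealC F).toIdeal) : CBall F) : CompletedAlgClosure F) =
      (ζ : CompletedAlgClosure F) - 1 := fun _ => rfl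
  have hpt_inj : Function.Injective pt := by
    intro ζ ζ' h
    have h' := congrArg (fun z : (maxNilIdealC F).toIdeal => ((z : CBall F) : CompletedAlgClosure F)) h
    simp only [hpt_coe, sub_left_inj] at h'
    exact Subtype.ext h'
  -- `Θ(ζ - 1)` is a division point: `g ζ` with `Θ (pt ζ) = ω (g ζ)`
  have hg : ∀ ζ : S, ∃ c, Θ (pt ζ) = ω c := fun ζ => hΘω (pt ζ) (by
    rw [hpt_coe, add_sub_cancel]
    exact hmemS.mp ζ.2)
  choose g hgω using hg
  have hginj : Function.Injective g := fun ζ ζ' h =>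
    hpt_inj (hΘ (by rw [hgω, hgω, h]))
  have hcard : Fintype.card S = Fintype.card 𝓀[F] := by
    rw [Fintype.card_coe, hScard, ← Nat.card_eq_fintype_card, hq]
  have hgbij : Function.Bijective g := (Fintype.bijective_iff_injective_and_card g).mpr ⟨hginj, hcard⟩
  set e := Equiv.ofBijective g hgbij with hedef
  refine ⟨fun c => ((e.symm c : S) : CompletedAlgClosure F), ?_, fun c => hmemS.mp (e.symm c).2, fun c => ?_⟩
  · exact Subtype.val_injective.comp e.symm.injective
  · refine ⟨pt (e.symm c), hpt_coe _, ?_⟩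
    rw [hgω]
    exact congrArg ω (e.apply_symm_apply c)


end Literature.NumberTheory.GaloisRepresentations

end
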